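import Summits.BirchSwinnertonDyer.Rank1Residual.O5.CharTwistPrimeLevel
import HarnessLib

/-!
# TWIN AT TWO, part 1 (`m ∈ {4, 8}`, `m² ∣ N`): the twist by a quadratic character of `2`-power
# modulus — `q`-expansion algebra, translates by `u/m` on `Γ₀(N)`, and the HALF-TRANSLATE SIGN —
# cell `bsd-f2-manin` (D-0131 (3) frontier: the Manin constant at additive primes), analytic lens
# (seat `-an`, g7, MEMO-an §51)

A TOOL file (theorems only; no definition, no named fact, no `sorry`; nothing asserted about any
elliptic curve): the `p = 2` companion of the O5 cell's `CharTwistThreeIsometry` §1–§3 /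
`CharTwistPrimeLevel` (which exclude `p = 2`: the quadratic characters of `2`-power conductor live
mod `4` and mod `8`, not mod `2`). For `m² ∣ N`, `χ` quadratic mod `m` with `IsUnit (n : ZMod m) ↔ n`
odd (`m = 4, 8`), and the tree's twist `R f := charTwist N _ _ _ f` (`aₙ(R f) = χ(n) aₙ(f)`,
Shimura 1971, Prop. 3.64): linearity, integrality, `2`-depletion of `R f`, the involution
`R(R f) = f` on `2`-depleted `f` (`aₙ(f) = 0` for even `n`), the expansion
`R y = g(χ)⁻¹ ∑_u χ(u) Y_u` over cusp forms `Y_u` with `⇑Y_u = y ∣ [1, u/m; 0, 1]` (which exist on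
`Γ₀(N)` for `m ∣ 24`, `m² ∣ N`: tree `exists_gamma0Translate`), the adjointness
`⟨T_u f, T_v x⟩ = ⟨f, T_{v−u} x⟩` (Diamond–Shurman Prop. 5.5.2(a), tree
`peterssonProduct_translate_adjoint` + `conj_translGL_gamma0_eq`), and the ONE NEW INPUT at `2`:
**the half-translate sign `T_{q ± 1/2} f = −T_q f` for `2`-depleted `f`** (`e^{πi n} = −1` for odd
`n`). The isometries at conductor `4` and `8` are in `CharTwistTwoIsometry.lean`; TWIN and the
`p = 2` slices of E-desc-20 in `CongruenceNumberTwistTwo.lean`.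

References: [Shimura1971] Prop. 3.64; [DiamondShurman2005] Prop. 5.5.2(a); tree templates
`O5/CharTwistThreeIsometry.lean`, `O5/CharTwistPrimeLevel.lean` (cell `b2b-bsdres`).
-/

noncomputable section

open scoped MatrixGroups ModularForm ComplexConjugate Real

open Matrix.SpecialLinearGroup Matrix.GeneralLinearGroup UpperHalfPlane Complex ConjAct
  CongruenceSubgroup Literature.NumberTheory.EllipticCurves.ModularForms
  Literature.NumberTheory.Automorphic Summit.BirchSwinnertonDyer.Rank1Residual.O5

namespace Summit.BirchSwinnertonDyer.Rank1Residual.ManinAdditive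

namespace TwistAtTwo

/-! ### §1 Quadratic characters of `2`-power modulus and the twist: `q`-expansion algebra -/

section Algebra

variable {N m : ℕ} [NeZero N] [NeZero m] {k : ℤ} (hm : m ^ 2 ∣ N) {χ : DirichletCharacter ℂ m}
  (hχ : χ.IsQuadratic) (hu : ∀ n : ℕ, IsUnit (n : ZMod m) ↔ ¬ 2 ∣ n)

/-- `IsUnit (n : ZMod 4) ↔ n` odd. [folklore] -/
theorem isUnit_natCast_zmod_four_iff (n : ℕ) : IsUnit (n : ZMod 4) ↔ ¬ 2 ∣ n := by
  rw [ZMod.isUnit_iff_coprime, show (4 : ℕ) = 2 ^ 2 from rfl, Nat.coprime_pow_right_iff two_pos,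
    Nat.coprime_comm, Nat.Prime.coprime_iff_not_dvd Nat.prime_two]

/-- `IsUnit (n : ZMod 8) ↔ n` odd. [folklore] -/
theorem isUnit_natCast_zmod_eight_iff (n : ℕ) : IsUnit (n : ZMod 8) ↔ ¬ 2 ∣ n := by
  rw [ZMod.isUnit_iff_coprime, show (8 : ℕ) = 2 ^ 3 from rfl, Nat.coprime_pow_right_iff three_pos,
    Nat.coprime_comm, Nat.Prime.coprime_iff_not_dvd Nat.prime_two]

include hu in
omit [NeZero m] in
/-- `χ(n) = 0` for even `n` (mod `4` or `8`, `n` is a non-unit). [folklore] -/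
theorem chi_natCast_eq_zero_of_two_dvd (χ : DirichletCharacter ℂ m) {n : ℕ} (hn : 2 ∣ n) :
    χ (n : ZMod m) = 0 :=
  χ.map_nonunit fun h ↦ (hu n).mp h hn

include hχ hu in
omit [NeZero m] in
/-- `χ(n)² = 1` for odd `n` and `χ` quadratic. [folklore] -/
theorem chi_natCast_sq_of_not_two_dvd {n : ℕ} (hn : ¬ 2 ∣ n) : χ (n : ZMod m) ^ 2 = 1 :=
  apply_sq_eq_one_of_isQuadratic hχ ((hu n).mpr hn)

include hχ in
omit [NeZero m] in
/-- The values of a quadratic character are integers. [folklore] -/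
theorem exists_intCast_eq_chi (a : ZMod m) : ∃ z : ℤ, (z : ℂ) = χ a := by
  rcases hχ a with h | h | h
  · exact ⟨0, by rw [h, Int.cast_zero]⟩
  · exact ⟨1, by rw [h, Int.cast_one]⟩
  · exact ⟨-1, by rw [h, Int.cast_neg, Int.cast_one]⟩

/-- The twist is additive (coefficientwise). [folklore] -/
theorem charTwist_add (hprim : χ.IsPrimitive) (f g : CuspForm (Gamma0 N) k) :
    charTwist N dvd_rfl hm hχ (f + g) = charTwist N dvd_rfl hm hχ f + charTwist N dvd_rfl hm hχ g := by
  refine eq_of_forall_cuspCoeff_eq_gamma0 fun n ↦ ?_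
  rw [cuspCoeff_add_form (one_mem_strictPeriods_coe_gamma0 N), cuspCoeff_charTwist N _ hm hχ hprim,
    cuspCoeff_charTwist N _ hm hχ hprim, cuspCoeff_charTwist N _ hm hχ hprim,
    cuspCoeff_add_form (one_mem_strictPeriods_coe_gamma0 N), mul_add]

/-- The twist is `ℂ`-homogeneous (coefficientwise). [folklore] -/
theorem charTwist_smul (hprim : χ.IsPrimitive) (c : ℂ) (f : CuspForm (Gamma0 N) k) :
    charTwist N dvd_rfl hm hχ (c • f) = c • charTwist N dvd_rfl hm hχ f := by
  refine eq_of_forall_cuspCoeff_eq_gamma0 fun n ↦ ?_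
  rw [cuspCoeff_smul, cuspCoeff_charTwist N _ hm hχ hprim, cuspCoeff_charTwist N _ hm hχ hprim,
    cuspCoeff_smul, mul_left_comm]

/-- The twist is `ℤ`-homogeneous. [folklore] -/
theorem charTwist_zsmul (hprim : χ.IsPrimitive) (z : ℤ) (f : CuspForm (Gamma0 N) k) :
    charTwist N dvd_rfl hm hχ (z • f) = z • charTwist N dvd_rfl hm hχ f := by
  rw [← Int.cast_smul_eq_zsmul ℂ z f, charTwist_smul hm hχ hprim, Int.cast_smul_eq_zsmul]

include hu in
/-- The twist is `2`-DEPLETED: `aₙ(R f) = 0` for even `n` (`χ(n) = 0`). [folklore] -/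
theorem cuspCoeff_charTwist_eq_zero_of_two_dvd (hprim : χ.IsPrimitive) (f : CuspForm (Gamma0 N) k)
    {n : ℕ} (hn : 2 ∣ n) : cuspCoeff (charTwist N dvd_rfl hm hχ f) n = 0 := by
  rw [cuspCoeff_charTwist N _ hm hχ hprim, chi_natCast_eq_zero_of_two_dvd hu χ hn, zero_mul]

include hu in
/-- **The twist is an INVOLUTION on `2`-depleted forms**: `R(R f) = f` (`χ(n)² = 1`, `n` odd). [folklore] -/
theorem charTwist_charTwist (hprim : χ.IsPrimitive) {f : CuspForm (Gamma0 N) k}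
    (hf : ∀ n, 2 ∣ n → cuspCoeff f n = 0) :
    charTwist N dvd_rfl hm hχ (charTwist N dvd_rfl hm hχ f) = f := by
  refine eq_of_forall_cuspCoeff_eq_gamma0 fun n ↦ ?_
  rw [cuspCoeff_charTwist N _ hm hχ hprim, cuspCoeff_charTwist N _ hm hχ hprim, ← mul_assoc, ← sq]
  by_cases hn : 2 ∣ n
  · rw [hf n hn, mul_zero]
  · rw [chi_natCast_sq_of_not_two_dvd hχ hu hn, one_mul]

/-- The twist maps `S_k(Γ₀(N); ℤ)` into itself (`χ(n) ∈ {0, ±1}`). [folklore] -/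
theorem charTwist_mem_integralCuspForms0 (hprim : χ.IsPrimitive) {f : CuspForm (Gamma0 N) k}
    (hf : f ∈ integralCuspForms0 N k) : charTwist N dvd_rfl hm hχ f ∈ integralCuspForms0 N k := by
  intro n
  obtain ⟨a, ha⟩ := hf n
  obtain ⟨z, hz⟩ := exists_intCast_eq_chi hχ (n : ZMod m)
  exact ⟨z * a, by rw [cuspCoeff_charTwist N _ hm hχ hprim, Int.cast_mul, hz, ha]⟩

/-- **`R y = g(χ)⁻¹ ∑_u χ(u) Yᵤ`** as CUSP FORMS on `Γ₀(N)`, for any family of cusp forms `Yᵤ` whose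
underlying functions are the translates `y ∣[k] [1, u/m; 0, 1]`. [cite: Shimura1971, Prop. 3.64] -/
theorem charTwist_eq_smul_sum (y : CuspForm (Gamma0 N) k) (Y : ℤ → CuspForm (Gamma0 N) k)
    (hY : ∀ u : ℤ, (⇑(Y u) : ℍ → ℂ) = (⇑y : ℍ → ℂ) ∣[k] glCast (translGL ((u : ℚ) / m) : GL (Fin 2) ℚ)) :
    charTwist N dvd_rfl hm hχ y =
      (gaussSum χ⁻¹ (ZMod.stdAddChar (N := m)))⁻¹ • ∑ u : ZMod m, χ⁻¹ u • Y (u.val : ℤ) := by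
  apply DFunLike.ext'
  rw [coe_charTwist, coe_twistRaw, CuspForm.IsGLPos.coe_smul]
  congr 1
  have h := map_sum (CuspForm.coeHom (Γ := ((Gamma0 N : Subgroup SL(2, ℤ)) :
    Subgroup (GL (Fin 2) ℝ))) (k := k)) (fun u : ZMod m ↦ χ⁻¹ u • Y (u.val : ℤ)) Finset.univ
  refine (Finset.sum_congr rfl fun u _ ↦ ?_).trans h.symm
  change χ⁻¹ u • ((⇑y : ℍ → ℂ) ∣[k] twistT u) = ⇑(χ⁻¹ u • Y (u.val : ℤ))
  rw [CuspForm.IsGLPos.coe_smul, hY, ← glCast_translGL_eq_twistT u]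

end Algebra

/-! ### §2 Translates by `u/m` on `Γ₀(N)` (`m ∣ 24`, `m² ∣ N`) and the half-translate sign -/

section Translate

variable {N m : ℕ} [NeZero N] [NeZero m] {k : ℤ}

/-- **Translates exist on `Γ₀(N)`** (`m² ∣ N`, `m ∣ 24`): some `X ∈ S_k(Γ₀(N))` has underlying
function `x ∣[k] [1, u/m; 0, 1]` (tree `exists_gamma0Translate`). [cite: DiamondShurman2005, Prop. 5.5.2(a)] -/
theorem exists_translate (hm : m ^ 2 ∣ N) (h24 : m ∣ 24) (x : CuspForm (Gamma0 N) k) (u : ℤ) :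
    ∃ X : CuspForm (Gamma0 N) k,
      (⇑X : ℍ → ℂ) = (⇑x : ℍ → ℂ) ∣[k] glCast (translGL ((u : ℚ) / m) : GL (Fin 2) ℚ) :=
  exists_gamma0Translate N hm h24 x u

/-- **Adjointness of translates** (DS Prop. 5.5.2(a), `α = [1, u/m; 0, 1]` normalising `Γ₀(N)`):
`⇑F = f∣[1,u/m;0,1]`, `⇑X = x∣[1,v/m;0,1]`, `⇑Y = x∣[1,w/m;0,1]`, `u + w = v` ⇒ `⟨F, X⟩ = ⟨f, Y⟩`.
[cite: DiamondShurman2005, Prop. 5.5.2(a)] -/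
theorem peterssonProduct_translate_translate (hm : m ^ 2 ∣ N) (h24 : m ∣ 24)
    {f x F X Y : CuspForm (Gamma0 N) k} {u v w : ℤ} (huvw : u + w = v)
    (hF : (⇑F : ℍ → ℂ) = (⇑f : ℍ → ℂ) ∣[k] glCast (translGL ((u : ℚ) / m) : GL (Fin 2) ℚ))
    (hX : (⇑X : ℍ → ℂ) = (⇑x : ℍ → ℂ) ∣[k] glCast (translGL ((v : ℚ) / m) : GL (Fin 2) ℚ))
    (hY : (⇑Y : ℍ → ℂ) = (⇑x : ℍ → ℂ) ∣[k] glCast (translGL ((w : ℚ) / m) : GL (Fin 2) ℚ)) :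
    peterssonProduct (Gamma0 N) k F X = peterssonProduct (Gamma0 N) k f Y := by
  subst huvw
  have hSL : ((Gamma0 N : Subgroup SL(2, ℤ)) : Subgroup (GL (Fin 2) ℝ)) ≤ 𝒮ℒ :=
    Subgroup.map_le_range _ _
  have hYX : (⇑Y : ℍ → ℂ) = (⇑X : ℍ → ℂ) ∣[k] glCast (translGL (-((u : ℚ) / m)) : GL (Fin 2) ℚ) := by
    rw [hY, hX, ← SlashAction.slash_mul, glCast_translGL_mul_glCast_translGL]
    congr 3
    push_cast
    ring
  have h := peterssonProduct_translate_adjoint ((Gamma0 N : Subgroup SL(2, ℤ)) : Subgroup (GL (Fin 2) ℝ))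
    hSL k (translGL ((u : ℚ) / m)) (translGL (-((u : ℚ) / m))) (coe_translGL_neg_eq_adjugate _)
    ((Gamma0 N : Subgroup SL(2, ℤ)) : Subgroup (GL (Fin 2) ℝ))
    (conj_translGL_gamma0_eq hm h24 u).symm hSL f X F Y hF hYX
  rw [peterssonProduct_conj_symm_holds _ k X F, h, peterssonProduct_conj_symm_holds _ k f Y,
    Complex.conj_conj]

omit [NeZero N] [NeZero m] in
/-- **Integer translates coincide**: `X_{u'} = X_u` when `u'/m = u/m + j`, `j ∈ ℤ`. [folklore] -/
theorem translate_eq_translate {x : CuspForm (Gamma0 N) k} {X : ℤ → CuspForm (Gamma0 N) k}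
    (hX : ∀ u : ℤ, (⇑(X u) : ℍ → ℂ) = (⇑x : ℍ → ℂ) ∣[k] glCast (translGL ((u : ℚ) / m) : GL (Fin 2) ℚ))
    {u u' j : ℤ} (h : (u' : ℚ) / m = (u : ℚ) / m + j) : X u' = X u := by
  apply DFunLike.ext'
  rw [hX u', hX u, h, PrimeTwist.slash_translGL_add_intCast]

/-- `e^{2πi q n} = −1` for `q = ±1/2` and odd `n`. [folklore] -/
theorem exp_two_pi_I_mul_eq_neg_one {q : ℚ} (hq : q = 1 / 2 ∨ q = -(1 / 2)) {n : ℕ} (hn : ¬ 2 ∣ n) :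
    Complex.exp (2 * π * Complex.I * q * n) = -1 := by
  have hodd : Odd n := Nat.odd_iff.mpr (Nat.two_dvd_ne_zero.mp hn)
  rcases hq with rfl | rfl
  · have h : (2 * π * Complex.I * (((1 / 2 : ℚ)) : ℂ) * n : ℂ) = n * (π * Complex.I) := by
      push_cast; ring
    rw [h, Complex.exp_nat_mul, Complex.exp_pi_mul_I, hodd.neg_one_pow]
  · have h : (2 * π * Complex.I * (((-(1 / 2) : ℚ)) : ℂ) * n : ℂ) = -(n * (π * Complex.I)) := by
      push_cast; ring
    rw [h, Complex.exp_neg, Complex.exp_nat_mul, Complex.exp_pi_mul_I, hodd.neg_one_pow, inv_neg, inv_one]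

omit [NeZero N] in
/-- **THE HALF-TRANSLATE SIGN: `T_{q ± 1/2} f = −T_q f` for `2`-depleted `f`** (`aₙ(T_q f) = e^{2πi q n} aₙ(f)`
and `e^{πi n} = −1` for odd `n`, `aₙ(f) = 0` for even `n`). The one input at `2` beyond the O5 template. [folklore] -/
theorem translate_eq_neg_translate {f G G' : CuspForm (Gamma0 N) k} {q q' : ℚ}
    (hG : (⇑G : ℍ → ℂ) = (⇑f : ℍ → ℂ) ∣[k] glCast (translGL q : GL (Fin 2) ℚ))
    (hG' : (⇑G' : ℍ → ℂ) = (⇑f : ℍ → ℂ) ∣[k] glCast (translGL q' : GL (Fin 2) ℚ))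
    (hq : q' - q = 1 / 2 ∨ q' - q = -(1 / 2)) (hf : ∀ n, 2 ∣ n → cuspCoeff f n = 0) : G' = -G := by
  refine eq_of_forall_cuspCoeff_eq_gamma0 fun n ↦ ?_
  rw [cuspCoeff_neg_form (one_mem_strictPeriods_coe_gamma0 N), cuspCoeff_of_coe_eq_slash_translGL hG',
    cuspCoeff_of_coe_eq_slash_translGL hG]
  by_cases hn : 2 ∣ n
  · rw [hf n hn, mul_zero, mul_zero, neg_zero]
  · have h := exp_two_pi_I_mul_eq_neg_one hq hn
    push_cast at h
    rw [show (2 * π * Complex.I * (q' : ℂ) * n : ℂ) =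
        2 * π * Complex.I * (q : ℂ) * n + 2 * π * Complex.I * ((q' : ℂ) - (q : ℂ)) * n by ring,
      Complex.exp_add, h]
    ring

omit [NeZero N] in
/-- `T_{±1/2} f = −f` for `2`-depleted `f`. [folklore] -/
theorem translate_eq_neg {f G : CuspForm (Gamma0 N) k} {q : ℚ}
    (hG : (⇑G : ℍ → ℂ) = (⇑f : ℍ → ℂ) ∣[k] glCast (translGL q : GL (Fin 2) ℚ))
    (hq : q = 1 / 2 ∨ q = -(1 / 2)) (hf : ∀ n, 2 ∣ n → cuspCoeff f n = 0) : G = -f := by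
  have hf0 : (⇑f : ℍ → ℂ) = (⇑f : ℍ → ℂ) ∣[k] glCast (translGL 0 : GL (Fin 2) ℚ) := by
    rw [glCast_translGL_zero, SlashAction.slash_one]
  exact translate_eq_neg_translate hf0 hG (by simpa using hq) hf

end Translate

end TwistAtTwo

end Summit.BirchSwinnertonDyer.Rank1Residual.ManinAdditive
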